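import Summits.QuantumFields.BalabanUV.T4Continuum.Support.U3PolymerDictionaryNE9Face

/-!
# U3PolymerDictionaryNE9FaceD6 — the D-6 CONSUMPTION FACE of row NE9 under the substrate's LAST-COUPLING reading:
# sourcing maps of record `oRecLast` ∕ `iRecLast`, the step's data at output scale `k + 1` FACTOR through them when the raw
# species record and the insertion-operator datum read the coupling sequence only at `g k`, and then NE5's functional of
# record satisfies NE9's outer binder `Factorises` at the BACKGROUND slot — by name, nothing else to wire

Cell `pub-balaban`, BINDER row NE9 OWNER lineage `b2b-balaban-t4-ne9-p1` (gen 29, prover-b2b-balaban-t4-ne9-p1-g29-0): the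
owner's reading of the substrate cell's reply to OBJ-NE9-g28-1 (journal l.13226) — `substrate/typer/SubstrateSketch.v0.3.lean`
§D6 (`LastCouplingOnly raw`, `recOf`, `raw_succ_eq_recOf`; typer draft 2026-08-20T13:11Z, for `SUBSTRATE-MAP.md` v0.3) and
substrate-p2's ACK (journal l.13393) — kernel part (prose part: `t4/b2b-balaban-t4-ne9-p1/g29/D6-READING-NE9-g29.md`).
Summits-side bookkeeping under the LEAN PLACEMENT RULE; the imported modules are used BY NAME and not edited; 0 estimate;
no `def … : Prop`; nothing printed is asserted.

HONEST FRAMING (T4-DAG p. 1).  Rung (B)+1 of the FINITE-VOLUME T⁴ continuum programme — NOT infinite volume, NOT a mass gap, NOT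
the Clay problem, NOT a proof of NE5 or NE9 (neither is PRINTED in [Balaban1987RG1]–[Balaban1989LargeFieldII]; spine PROVED 0∕9;
0∕18 NE9 leaves instantiated on Bałaban's objects).  HONEST DEPENDENCY (cell line, verbatim): continuum YM on T⁴ ⇐ BetaPertH ∧ nine
spine estimates (0/9 proved); BetaPertH ⇐ (D1) ∧ (D4) ∧ CAP+tail; G-an2-4 gates asym, D1 and NE2/3/4.  `FlowStep.BetaPertH`, (B),
(B^μ) do not occur.

WHY THIS FILE.  `U3PolymerDictionaryNE9Face.factorises_outB_KP_of_dataFactor` (p218863) inhabits NE9's outer binder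
`T4HistoryLipschitzOuter.Factorises` for NE5's functional of record `outB_KP S E₀ cB` at the BACKGROUND slot under two displayed
factorisation hypotheses `hop` ∕ `hins` with GENERAL sourcing maps `oRec` ∕ `iRec` (operator datum and inserted history from
(step, last coupling, background, TABLE)).  The substrate's reply fixes the sourcing maps CANONICALLY: NE5's slots carry
`rawB : (ℕ → ℝ) → BgB → ℕ → E → ℂ` (no table argument) and `D.insOpB : (ℕ → ℝ) → BgB → ℕ → IOp`, and the substrate COMMITS that
at output scale `k + 1` both read the coupling sequence ONLY at `g k` (`LastCouplingOnly`: kernel block `cov`∕`deltaKer`∕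
`gammaConstituent` coupling-free after the scaling `B = g_k B′`, [Balaban1987RG1] (2.10)–(2.12) pp. 267–268; potential block
`potQ` = the second-order coefficients of the localized Wilson-action terms `F^{(k)}(g_k, U, J, B)`, [Balaban1988RG2Cluster]
(1.37)–(1.40) pp. 10–11, and `potR` = the OPERATOR part of `𝐕″_k` in the sense of NE5's design rule R3 — the `F^{(k)}`-derived
part; the EARLIER-ACTIONS part `Σ_Y 𝐕′_k(Y, ·)` = the localisation of `E_k(U_k(exp i·)) − E_k(U_k)` (Lemma 1 (1.33) p. 9), which
depends on `g₀, …, g_{k−1}`, is TABLE-borne through the insertion `D.ins (k+1) a t` — its `t`-argument).  Under that commitment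
the sourcing maps are forced: `oRecLast S k s U _ := assemble (S.F (k+1)) (S.rawB (const s) U (k+1))` (the typer's
`opOf ∘ recOf`, table slot IDLE) and `iRecLast S k s U Q := S.D.ins (k+1) (S.D.insOpB (const s) U (k+1)) Q` (table slot = the
insertion's own table argument), and `hop` ∕ `hins` FOLLOW (§2).  So the substrate's S-U3 re-arms row NE9 by displaying exactly
two lines about its `Slots` instance `S` — `LastCouplingOnly S.rawB` and `LastCouplingOnly S.D.insOpB` (stated here in their
unfolded `∀`-form, so that the substrate's definition, once landed, applies by `Iff.rfl`) — and §3 is then NE9's `Factorises`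
for `outB_KP S E₀ cB` at the background slot with `act := actNE9 S (oRecLast S) (iRecLast S)`, on every window.  If instead the
substrate types the potential block WITH a table dependence inside `rawB` (substrate-p2's phrase «Lemma-2 data of (g k, U,
inserted table)», journal l.13393), `LastCouplingOnly S.rawB` is NOT available and the general face p218863 (`oRec` reading
the table) is the one to use — this file does not decide between the two typings; it makes the typer's one consumable by name.
* §1 `oRecLast`, `iRecLast` (DATA) and their unfoldings.
* §2 `step_opB_succ_eq_oRecLast`, `step_insB_succ_eq_iRecLast`: under the last-coupling reading of `S.rawB` resp. `S.D.insOpB`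
  the step's operator datum resp. inserted history at output scale `k + 1` IS the sourced one, for EVERY table in the idle
  resp. live table slot — p218863's `hop` ∕ `hins` with these maps, for every functional in the table.
* §3 `factorises_outB_KP_of_lastCoupling` (every window), `factorises_outB_KP_of_lastCouplingOn` (hypotheses only ON a window
  closed under `g ↦ const (g k)`; `const_apply_mem_window`: Bałaban's window `]0, γ]^ℕ` is), `factorises_outB_KP_of_lastCouplingOn_window`.
DISGUISE TEST: identities and a structural binder inhabited BY CONSTRUCTION under displayed hypotheses; nothing is NE9, nothing
is an estimate; the two `LastCouplingOnly` lines are MODEL commitments of the substrate's instance (true by construction of a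
record that reads `g (k+1-1)`), not analytic facts.

References (TYPES ∕ loci only): [Balaban1987RG1] T. Bałaban, CMP **109** (1987) 249–301, (2.10)–(2.13) pp. 267–268, p. 256,
p. 263; [Balaban1988RG2Cluster] T. Bałaban, CMP **116** (1988) 1–22, Lemma 1 (1.33)–(1.36) p. 9, (1.37)–(1.40) pp. 10–11,
Lemma 2 (1.41)–(1.43) p. 11, (2.13)–(2.14) pp. 14–15.
-/

noncomputable section

open scoped BigOperators

namespace Summit.QuantumFields.BalabanUV.T4Continuum.U3PolymerDictionaryNE9Face

open Literature.MathematicalPhysics.QuantumFieldTheory.Balaban1983to89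
open Literature.MathematicalPhysics.QuantumFieldTheory.Balaban1983to89.T4OutputRate (Carriers Functional NE9 Window)
open Literature.MathematicalPhysics.QuantumFieldTheory.Balaban1983to89.T4InputCauchyRateData (StepModel tableB)
open Literature.MathematicalPhysics.QuantumFieldTheory.Balaban1983to89.T4HistoryLipschitzOuter (Factorises)
open Summit.QuantumFields.BalabanUV.T4Continuum.B13Carriers (TwoRuns)
open Summit.QuantumFields.BalabanUV.T4Continuum.B13CarriersCubeChart (cubeChart)
open Summit.QuantumFields.BalabanUV.T4Continuum.B13OpDatum (OpDatum assemble)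
open Summit.QuantumFields.BalabanUV.T4Continuum.B13OpDatumJunctions (opOf)
open Summit.QuantumFields.BalabanUV.T4Continuum.B13HistInsertion (InsDatum)
open Summit.QuantumFields.BalabanUV.T4Continuum.B13StepOfRecord (Slots step step_opB step_insB)
open Summit.QuantumFields.BalabanUV.T4Continuum.B13KPStepOfRecord (outB_KP)
open Summit.QuantumFields.BalabanUV.T4Continuum.U3PolymerDictionary

variable {G : Type} [GaugeGroup G] {R : TwoRuns G} {E : Type} {IOp Hist : Type*} [NormedAddCommGroup Hist] [NormedSpace ℂ Hist]
  (S : Slots R E IOp Hist) (E₀ cB : ℝ)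

/-! ## §1 The sourcing maps of record under the last-coupling reading -/

/-- [folklore] DATA (no inequality inside): **THE OPERATOR-DATUM SOURCING MAP OF THE LAST-COUPLING READING** — at NE9 step `k`,
last coupling `s`, background `U`: NE5's operator datum of record at output scale `k + 1` read at the CONSTANT coupling sequence
`s` (the substrate typer's `opOf ∘ recOf`); the table slot is IDLE (every `g₀ … g_{k−1}`-dependence of Bałaban's step is carried by
the inserted history, [Balaban1988RG2Cluster] Lemma 1 (1.33) p. 9 — KIND only). -/
def oRecLast {Pot : Type*} : ℕ → ℝ → R.carriers.BgB → Pot → OpDatum E :=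
  fun k s U _ => assemble (S.F (k + 1)) (S.rawB (fun _ => s) U (k + 1))

/-- [folklore] DATA (no inequality inside): **THE INSERTED-HISTORY SOURCING MAP OF THE LAST-COUPLING READING** — the insertion of
record at output scale `k + 1`, read at the insertion-operator datum of the CONSTANT coupling sequence `s` and at the TABLE `Q`
(the live table slot: [Balaban1988RG2Cluster] (1.33) re-expresses the EARLIER actions — KIND only). -/
def iRecLast : ℕ → ℝ → R.carriers.BgB → (R.carriers.Dom → ℝ) → Hist :=
  fun k s U Q => S.D.ins (k + 1) (S.D.insOpB (fun _ => s) U (k + 1)) Q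

variable {S} in
/-- [folklore] `oRecLast` unfolds. -/
@[simp] theorem oRecLast_apply {Pot : Type*} (k : ℕ) (s : ℝ) (U : R.carriers.BgB) (Q : Pot) :
    oRecLast S k s U Q = assemble (S.F (k + 1)) (S.rawB (fun _ => s) U (k + 1)) := rfl

variable {S} in
/-- [folklore] `iRecLast` unfolds. -/
@[simp] theorem iRecLast_apply (k : ℕ) (s : ℝ) (U : R.carriers.BgB) (Q : R.carriers.Dom → ℝ) :
    iRecLast S k s U Q = S.D.ins (k + 1) (S.D.insOpB (fun _ => s) U (k + 1)) Q := rfl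

variable {S} in
/-- [folklore] The operator-datum sourcing map ignores its table slot. -/
theorem oRecLast_table_idle {Pot : Type*} (k : ℕ) (s : ℝ) (U : R.carriers.BgB) (Q Q' : Pot) :
    oRecLast S k s U Q = oRecLast S k s U Q' := rfl

/-! ## §2 The step's data at output scale `k + 1` FACTOR through the sourcing maps under the last-coupling reading -/

/-- [folklore] **`hop` UNDER THE LAST-COUPLING READING OF THE RAW RECORD.**  If run B's raw species record at output scale
`k + 1` reads the coupling sequence only at `g k` (displayed: `hraw` — the substrate's `LastCouplingOnly S.rawB`, unfolded), then
the step's operator datum of record there IS `oRecLast S k (g k) U Q`, for every coupling sequence `g`, background `U` and every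
(idle) table `Q`. -/
theorem step_opB_succ_eq_oRecLast {Pot : Type*}
    (hraw : ∀ (g g' : ℕ → ℝ) (U : R.carriers.BgB) (k : ℕ), g k = g' k → S.rawB g U (k + 1) = S.rawB g' U (k + 1))
    (g : ℕ → ℝ) (U : R.carriers.BgB) (k : ℕ) (Q : Pot) :
    (step S E₀ cB).opB g U (k + 1) = oRecLast S k (g k) U Q := by
  rw [step_opB, B13OpDatumJunctions.opOf_apply, oRecLast_apply, hraw g (fun _ => g k) U k rfl]

/-- [folklore] **`hins` UNDER THE LAST-COUPLING READING OF THE INSERTION-OPERATOR DATUM.**  If run B's insertion-operator datum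
at output scale `k + 1` reads the coupling sequence only at `g k` (displayed: `hiop` — `LastCouplingOnly S.D.insOpB`, unfolded),
then the step's inserted history of record there, at ANY table `Q`, IS `iRecLast S k (g k) U Q`. -/
theorem step_insB_succ_eq_iRecLast
    (hiop : ∀ (g g' : ℕ → ℝ) (U : R.carriers.BgB) (k : ℕ), g k = g' k → S.D.insOpB g U (k + 1) = S.D.insOpB g' U (k + 1))
    (g : ℕ → ℝ) (U : R.carriers.BgB) (k : ℕ) (Q : R.carriers.Dom → ℝ) :
    (step S E₀ cB).insB g U (k + 1) Q = iRecLast S k (g k) U Q := by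
  rw [step_insB, InsDatum.insB, iRecLast_apply, hiop g (fun _ => g k) U k rfl]

/-! ## §3 NE9's outer binder `Factorises` at the BACKGROUND slot under the last-coupling reading — every window -/

/-- [folklore] **`Factorises` INHABITED AT THE BACKGROUND SLOT UNDER THE SUBSTRATE'S LAST-COUPLING COMMITMENT (every window).**
If run B's raw species record and insertion-operator datum read the coupling sequence only at `g k` at output scale `k + 1`
(displayed: `hraw`, `hiop` — the two `LastCouplingOnly` lines the substrate's S-U3 instance is to display about its `Slots`), then
NE5's functional of record `outB_KP S E₀ cB` satisfies NE9's outer structural binder `T4HistoryLipschitzOuter.Factorises` on EVERY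
window `W`, with background slot `R.carriers.BgB`, the `g`-independent channel «the earlier table itself» and the new-term map read
through `actNE9 S (oRecLast S) (iRecLast S)`.  Proof: p218863's `factorises_outB_KP_of_dataFactor` with §2. -/
theorem factorises_outB_KP_of_lastCoupling (W : Set (ℕ → ℝ))
    (hraw : ∀ (g g' : ℕ → ℝ) (U : R.carriers.BgB) (k : ℕ), g k = g' k → S.rawB g U (k + 1) = S.rawB g' U (k + 1))
    (hiop : ∀ (g g' : ℕ → ℝ) (U : R.carriers.BgB) (k : ℕ), g k = g' k → S.D.insOpB g U (k + 1) = S.D.insOpB g' U (k + 1)) :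
    Factorises (C := R.carriers) (ι := R.carriers.BgB × R.carriers.Dom) (outB_KP S E₀ cB) W (fun _ _ H p => H p.1 p.2)
      fun k s Q U X => ((cubeChart R).geom.newTerm (actNE9 S (oRecLast S) (iRecLast S)) k s U X (fun Y => Q (U, Y))).re :=
  factorises_outB_KP_of_dataFactor S E₀ cB (oRecLast S) (iRecLast S)
    (fun g _ U k => step_opB_succ_eq_oRecLast S E₀ cB hraw g U k _)
    (fun g _ U k => step_insB_succ_eq_iRecLast S E₀ cB hiop g U k _)

/-- [folklore] **The same, with the last-coupling hypotheses displayed only ON the window** — for a window closed under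
`g ↦ (fun _ => g k)` (displayed: `hW`; Bałaban's `]0, γ]^ℕ` is, `const_apply_mem_window`).  This is the form in which a record
defined only for couplings inside its analyticity window states its last-coupling reading. -/
theorem factorises_outB_KP_of_lastCouplingOn {W : Set (ℕ → ℝ)} (hW : ∀ g ∈ W, ∀ k : ℕ, (fun _ : ℕ => g k) ∈ W)
    (hraw : ∀ g ∈ W, ∀ g' ∈ W, ∀ (U : R.carriers.BgB) (k : ℕ), g k = g' k → S.rawB g U (k + 1) = S.rawB g' U (k + 1))
    (hiop : ∀ g ∈ W, ∀ g' ∈ W, ∀ (U : R.carriers.BgB) (k : ℕ), g k = g' k → S.D.insOpB g U (k + 1) = S.D.insOpB g' U (k + 1)) :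
    Factorises (C := R.carriers) (ι := R.carriers.BgB × R.carriers.Dom) (outB_KP S E₀ cB) W (fun _ _ H p => H p.1 p.2)
      fun k s Q U X => ((cubeChart R).geom.newTerm (actNE9 S (oRecLast S) (iRecLast S)) k s U X (fun Y => Q (U, Y))).re := by
  refine factorises_outB_KP_of_dataFactor S E₀ cB (oRecLast S) (iRecLast S) (fun g hg U k => ?_) (fun g hg U k => ?_)
  · rw [step_opB, B13OpDatumJunctions.opOf_apply, oRecLast_apply, hraw g hg (fun _ => g k) (hW g hg k) U k rfl]
  · rw [step_insB, InsDatum.insB, iRecLast_apply, hiop g hg (fun _ => g k) (hW g hg k) U k rfl]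

/-- [folklore] Bałaban's coupling window `]0, γ]^ℕ` is closed under `g ↦ (fun _ => g k)`. -/
theorem const_apply_mem_window {γ : ℝ} {g : ℕ → ℝ} (hg : g ∈ Window γ) (k : ℕ) : (fun _ : ℕ => g k) ∈ Window γ :=
  fun _ => hg k

/-- [folklore] **`Factorises` on Bałaban's window `]0, γ]^ℕ` under the last-coupling reading displayed ON the window.** -/
theorem factorises_outB_KP_of_lastCouplingOn_window {γ : ℝ}
    (hraw : ∀ g ∈ Window γ, ∀ g' ∈ Window γ, ∀ (U : R.carriers.BgB) (k : ℕ),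
      g k = g' k → S.rawB g U (k + 1) = S.rawB g' U (k + 1))
    (hiop : ∀ g ∈ Window γ, ∀ g' ∈ Window γ, ∀ (U : R.carriers.BgB) (k : ℕ),
      g k = g' k → S.D.insOpB g U (k + 1) = S.D.insOpB g' U (k + 1)) :
    Factorises (C := R.carriers) (ι := R.carriers.BgB × R.carriers.Dom) (outB_KP S E₀ cB) (Window γ) (fun _ _ H p => H p.1 p.2)
      fun k s Q U X => ((cubeChart R).geom.newTerm (actNE9 S (oRecLast S) (iRecLast S)) k s U X (fun Y => Q (U, Y))).re :=
  factorises_outB_KP_of_lastCouplingOn S E₀ cB (fun _ hg k => const_apply_mem_window hg k) hraw hiop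

end Summit.QuantumFields.BalabanUV.T4Continuum.U3PolymerDictionaryNE9Face

end
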